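import Mathlib

/-!
# The Ostrowski–Price determinant minorant for diagonally dominant matrices

Kernel anchor for `DENSITY-XY.md` THEOREM G.34, Step 5 (repair cell b2b-imbrie, XY / free-fermion
rung).  If a real square matrix `A` has `Σ_{j ≠ i} |A i j| < A i i` for every row `i` (strict diagonal
dominance with positive diagonal), then
`det A ≥ ∏ᵢ (A i i − Σ_{j ≠ i} |A i j|)`
(Ostrowski 1937, Price 1951).  In G.34 it is applied to the spectral Jacobian `S = (ψᵢ(j)²)` after the
permutation `σ` of a fibre point (`S̃ = S Pσᵀ` has diagonal `≥ 1 − r_j` and off-diagonal row sums `r_j`),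
giving `|det S| ≥ ∏ⱼ (1 − 2 r_j)`.  Proof: one step of Gaussian elimination — the Schur complement of
the pivot is again strictly dominant with row margins at least those of `A` — and induction on the
size.  Elementary real algebra only; nothing here asserts anything about the interacting chain (LLA).
-/

namespace Literature.MathematicalPhysics.QuantumLattice.Imbrie2016

open Finset

/-- Off-diagonal sums over `Fin (n+1)`, row `0`: `Σ_{j ≠ 0} f j = Σ_{j : Fin n} f j.succ`.  [folklore] -/
theorem sum_erase_zero_eq_sum_succ {n : ℕ} (f : Fin (n + 1) → ℝ) :
    ∑ j ∈ univ.erase 0, f j = ∑ j : Fin n, f j.succ := by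
  rw [Finset.sum_erase_eq_sub (Finset.mem_univ _), Fin.sum_univ_succ]
  ring

/-- Off-diagonal sums over `Fin (n+1)`, row `i.succ`:
`Σ_{j ≠ i.succ} f j = f 0 + Σ_{j ≠ i} f j.succ`.  [folklore] -/
theorem sum_erase_succ_eq {n : ℕ} (f : Fin (n + 1) → ℝ) (i : Fin n) :
    ∑ j ∈ univ.erase i.succ, f j = f 0 + ∑ j ∈ univ.erase i, f j.succ := by
  rw [Finset.sum_erase_eq_sub (Finset.mem_univ _), Finset.sum_erase_eq_sub (Finset.mem_univ _),
    Fin.sum_univ_succ]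
  ring

/-- **Ostrowski–Price minorant.**  If `Σ_{j ≠ i} |A i j| < A i i` for every row, then
`∏ᵢ (A i i − Σ_{j ≠ i} |A i j|) ≤ det A`.  [folklore] -/
theorem prod_margin_le_det : ∀ (n : ℕ) (A : Matrix (Fin n) (Fin n) ℝ),
    (∀ i, ∑ j ∈ univ.erase i, |A i j| < A i i) →
    ∏ i, (A i i - ∑ j ∈ univ.erase i, |A i j|) ≤ A.det := by
  intro n
  induction n with
  | zero =>
    intro A _
    simp [Matrix.det_isEmpty]
  | succ n ih =>
    intro A h
    -- the pivot
    have hoff_nonneg : ∀ i, 0 ≤ ∑ j ∈ univ.erase i, |A i j| :=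
      fun i => Finset.sum_nonneg fun j _ => abs_nonneg _
    have hp : 0 < A 0 0 := lt_of_le_of_lt (hoff_nonneg 0) (h 0)
    set p : ℝ := A 0 0 with hp_def
    set r0 : ℝ := ∑ j ∈ univ.erase 0, |A 0 j| with hr0_def
    have hr0 : r0 < p := h 0
    have hr0' : r0 = ∑ j : Fin n, |A 0 j.succ| := sum_erase_zero_eq_sum_succ (fun j => |A 0 j|)
    -- Gaussian elimination below the pivot
    set c : Fin (n + 1) → ℝ := fun i => if i = 0 then 0 else A i 0 / p with hc_def
    set A' : Matrix (Fin (n + 1)) (Fin (n + 1)) ℝ := fun i j => A i j - c i * A 0 j with hA'_def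
    have hc0 : c 0 = 0 := by simp [hc_def]
    have hA'0 : ∀ j, A' 0 j = A 0 j := by
      intro j; simp [hA'_def, hc0]
    have hdetA : A.det = A'.det := by
      refine Matrix.det_eq_of_forall_row_eq_smul_add_const c 0 hc0 (fun i j => ?_)
      rw [hA'0]
      simp only [hA'_def]
      ring
    have hcol : ∀ i : Fin n, A' i.succ 0 = 0 := by
      intro i
      have hne : (i.succ : Fin (n + 1)) ≠ 0 := Fin.succ_ne_zero i
      simp only [hA'_def, hc_def, hne, if_false]
      rw [← hp_def]
      field_simp
      ring
    -- the Schur complement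
    set B : Matrix (Fin n) (Fin n) ℝ := A'.submatrix Fin.succ Fin.succ with hB_def
    have hBentry : ∀ i j, B i j = A i.succ j.succ - A i.succ 0 / p * A 0 j.succ := by
      intro i j
      have hne : (i.succ : Fin (n + 1)) ≠ 0 := Fin.succ_ne_zero i
      simp [hB_def, hA'_def, hc_def, hne]
    have hLap : A'.det = p * B.det := by
      rw [Matrix.det_succ_column_zero, Fin.sum_univ_succ]
      have hrest : ∑ i : Fin n, (-1) ^ ((i.succ : Fin (n + 1)) : ℕ) * A' i.succ 0 *
          (A'.submatrix (Fin.succAbove i.succ) Fin.succ).det = 0 := by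
        refine Finset.sum_eq_zero fun i _ => ?_
        rw [hcol i]; ring
      rw [hrest, add_zero, Fin.succAbove_zero, hA'0]
      simp [hB_def, hp_def]
    -- margins of the Schur complement dominate the margins of `A`
    have hmarg : ∀ i : Fin n,
        A i.succ i.succ - ∑ j ∈ univ.erase i.succ, |A i.succ j|
          ≤ B i i - ∑ j ∈ univ.erase i, |B i j| := by
      intro i
      have hq : 0 ≤ |A i.succ 0| / p := div_nonneg (abs_nonneg _) hp.le
      -- diagonal entry
      have hdiag : A i.succ i.succ - |A i.succ 0| / p * |A 0 i.succ| ≤ B i i := by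
        rw [hBentry]
        have h1 : A i.succ 0 / p * A 0 i.succ ≤ |A i.succ 0| / p * |A 0 i.succ| := by
          calc A i.succ 0 / p * A 0 i.succ ≤ |A i.succ 0 / p * A 0 i.succ| := le_abs_self _
            _ = |A i.succ 0| / p * |A 0 i.succ| := by rw [abs_mul, abs_div, abs_of_pos hp]
        linarith
      -- off-diagonal entries
      have hoffB : ∑ j ∈ univ.erase i, |B i j|
          ≤ ∑ j ∈ univ.erase i, |A i.succ j.succ| + |A i.succ 0| / p * ∑ j ∈ univ.erase i, |A 0 j.succ| := by
        rw [Finset.mul_sum, ← Finset.sum_add_distrib]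
        refine Finset.sum_le_sum fun j _ => ?_
        rw [hBentry]
        calc |A i.succ j.succ - A i.succ 0 / p * A 0 j.succ|
            ≤ |A i.succ j.succ| + |A i.succ 0 / p * A 0 j.succ| := abs_sub _ _
          _ = |A i.succ j.succ| + |A i.succ 0| / p * |A 0 j.succ| := by
              rw [abs_mul, abs_div, abs_of_pos hp]
      -- the row-0 sum seen from row i
      have hrow0 : |A 0 i.succ| + ∑ j ∈ univ.erase i, |A 0 j.succ| = r0 := by
        rw [hr0', Finset.add_sum_erase _ (fun j => |A 0 j.succ|) (Finset.mem_univ i)]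
      have hqr : |A i.succ 0| / p * r0 ≤ |A i.succ 0| := by
        have h1 : r0 / p ≤ 1 := (div_le_one hp).2 hr0.le
        have h2 : |A i.succ 0| / p * r0 = |A i.succ 0| * (r0 / p) := by ring
        rw [h2]
        calc |A i.succ 0| * (r0 / p) ≤ |A i.succ 0| * 1 :=
              mul_le_mul_of_nonneg_left h1 (abs_nonneg _)
          _ = |A i.succ 0| := mul_one _
      have hrowA : ∑ j ∈ univ.erase i.succ, |A i.succ j|
          = |A i.succ 0| + ∑ j ∈ univ.erase i, |A i.succ j.succ| :=
        sum_erase_succ_eq (fun j => |A i.succ j|) i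
      rw [hrowA]
      have hsplit : |A i.succ 0| / p * |A 0 i.succ| + |A i.succ 0| / p * ∑ j ∈ univ.erase i, |A 0 j.succ|
          = |A i.succ 0| / p * r0 := by rw [← hrow0]; ring
      linarith
    -- the Schur complement is strictly dominant, so the induction hypothesis applies
    have hmargA_pos : ∀ i : Fin (n + 1), 0 < A i i - ∑ j ∈ univ.erase i, |A i j| :=
      fun i => sub_pos.2 (h i)
    have hB : ∀ i : Fin n, ∑ j ∈ univ.erase i, |B i j| < B i i := by
      intro i
      have := lt_of_lt_of_le (hmargA_pos i.succ) (hmarg i)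
      linarith
    have hIH := ih B hB
    have hprodB : ∏ i : Fin n, (A i.succ i.succ - ∑ j ∈ univ.erase i.succ, |A i.succ j|)
        ≤ B.det := by
      refine le_trans ?_ hIH
      exact Finset.prod_le_prod (fun i _ => (hmargA_pos i.succ).le) fun i _ => hmarg i
    have hprod_nonneg : 0 ≤ ∏ i : Fin n, (A i.succ i.succ - ∑ j ∈ univ.erase i.succ, |A i.succ j|) :=
      Finset.prod_nonneg fun i _ => (hmargA_pos i.succ).le
    -- assemble
    rw [Fin.prod_univ_succ, hdetA, hLap]
    have hm0 : A 0 0 - r0 ≤ p := by rw [hp_def]; linarith [hoff_nonneg 0]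
    have hm0' : 0 ≤ A 0 0 - r0 := (hmargA_pos 0).le
    calc (A 0 0 - r0) * ∏ i : Fin n, (A i.succ i.succ - ∑ j ∈ univ.erase i.succ, |A i.succ j|)
        ≤ p * ∏ i : Fin n, (A i.succ i.succ - ∑ j ∈ univ.erase i.succ, |A i.succ j|) :=
          mul_le_mul_of_nonneg_right hm0 hprod_nonneg
      _ ≤ p * B.det := mul_le_mul_of_nonneg_left hprodB hp.le

/-- **Ostrowski–Price, absolute form**: under strict row dominance with positive diagonal,
`∏ᵢ (A i i − Σ_{j ≠ i} |A i j|) ≤ |det A|` (and the left side is positive).  [folklore] -/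
theorem prod_margin_le_abs_det {n : ℕ} (A : Matrix (Fin n) (Fin n) ℝ)
    (h : ∀ i, ∑ j ∈ univ.erase i, |A i j| < A i i) :
    ∏ i, (A i i - ∑ j ∈ univ.erase i, |A i j|) ≤ |A.det| :=
  (prod_margin_le_det n A h).trans (le_abs_self _)

/-- **Positivity**: a strictly row-dominant real matrix with positive diagonal has `0 < det A`.
[folklore] -/
theorem det_pos_of_diagDominant {n : ℕ} (A : Matrix (Fin n) (Fin n) ℝ)
    (h : ∀ i, ∑ j ∈ univ.erase i, |A i j| < A i i) : 0 < A.det :=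
  lt_of_lt_of_le (Finset.prod_pos fun i _ => sub_pos.2 (h i)) (prod_margin_le_det n A h)

/-- **G.34 Step 5 form.**  If `S` has non-negative entries, row sums `≤ 1`... more precisely: if the
diagonal entries satisfy `1 − r i ≤ S i i` and the off-diagonal row sums are `≤ r i` with `2 r i < 1`,
then `∏ᵢ (1 − 2 rᵢ) ≤ det S`.  [folklore] -/
theorem prod_one_sub_two_mul_le_det {n : ℕ} (S : Matrix (Fin n) (Fin n) ℝ) (r : Fin n → ℝ)
    (hdiag : ∀ i, 1 - r i ≤ S i i) (hoff : ∀ i, ∑ j ∈ univ.erase i, |S i j| ≤ r i)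
    (hr : ∀ i, 2 * r i < 1) :
    ∏ i, (1 - 2 * r i) ≤ S.det := by
  have h : ∀ i, ∑ j ∈ univ.erase i, |S i j| < S i i := fun i => by
    linarith [hdiag i, hoff i, hr i]
  refine le_trans ?_ (prod_margin_le_det n S h)
  refine Finset.prod_le_prod (fun i _ => by linarith [hr i]) fun i _ => by
    linarith [hdiag i, hoff i]

end Literature.MathematicalPhysics.QuantumLattice.Imbrie2016
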